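import Summits.AtomisticToContinuum.Crystallization.Theorems.OverbindingBudgetAffineCompressedCutStack
import Summits.AtomisticToContinuum.Crystallization.Theorems.OverbindingBudgetAffineCompressedCutKernelStackH
import Summits.AtomisticToContinuum.Crystallization.Theorems.OverbindingBudgetAffineCompressedCutKernelStackF

/-!
# Overbinding budget — compressed cut: R3 «Stack» II — LAYER CLIMBING, UNIFORMISATION, record instances

Record: route `OverbindingBudget`, crux `RobustDefectLimitWindows` (stmt-AtomisticToContinuum-31280); open leaf NS♭₂ ⟸ 79K ⟸ LR(r₁)
(critic row 1428 (b), R3 «Stack»: "UP2 layer induction with two-parent agreement on the lower triangle, class recursion").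

WHAT THIS FILE PROVES (potential-free, sorry-free; bounds symbolic, record constants `10⁻⁴`, `3/2 + 1/450`, `0.9967 / 1.0011` only).
* §0 tables: `copies_basic` (lengths `≤ 18`, basal hexagon inside each aligned copy), `hexL_sub_shell`, and the `F⁻` in-layer one-parent row
  `kfNeg_fcc : kernelOneB fccNegL hexL fccL [fccNegL] = true` (kernel-decided; completes the in-layer rows E1 / KF for all four copies).
* §1 ★★ `layer_climb` — ONE LAYER UP OR DOWN: from a disc of hex radius `n+1` in one layer, uniformly charted onto the aligned copy `C` with link/position
  bounds `(τ, D)` and scales in `[ν, ν′]`, every point `λ₀ + c₀ + x` (`x` of hex radius `≤ n`) of the adjacent layer on side `sg` is an ESTABLISHED site: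
  two adjacent parents `x, x + e₀` of the disc, the cap configuration `(c₀, e₀, a₀)`, `…EstablishTwo.estab_child_two` with the two-parent tables; new
  bounds `τ⁺ = τ + (5/2)(2·10⁻⁴ν′ + 10⁻⁴·1.0011ν′)`, `D⁺ = D + 10⁻⁴ν′ + τ`, scales in `[0.9967ν, 1.0011ν′]`, copy from the table row of the child's type.
  Side conditions (all symbolic, discharged in R4): `2D + 10⁻⁴ν′ + τ < ν`, `(2τ + (5/2)·3·10⁻⁴ν′)√2 < β`, `2D + 2·10⁻⁴ν′ + 2τ < 0.9967ν`, ROOM.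
* §2 ★ `disc_uniform` — CLASS RECURSION: a disc each of whose points is established with SOME aligned copy is established with ONE aligned copy
  (`…Stack.copy_eq_of_adjacent` along `hex_descent` paths), under the reach / resolution conditions `γ + (D + 10⁻⁴ν′ + τ) + D ≤ (3/2 + 1/450)ν`,
  `18·(2D + 2·10⁻⁴ν′ + (1 + √2)τ)² < 6β²`.
* §4 `injOn_of_field` — obligation (O9) of critic row 1435 (B) (the `Set.InjOn (f j) ↑(P j)` input of R1/R2) DISCHARGED for every FRAMED site with
  `nn_j > 0`: chart-free, from the Literature `1`-separation of the patterns and the two record tolerances `1/1000`, `10⁻⁴`.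
* §3 record instances: `climb_hcp_up`, `climb_hcp_down` (from an `H` layer: E1 row, UP2 rows `up_hcp_*`), `climb_fcc_up`, `climb_fcc_down` (from an `F⁺`
  layer: KF row, `up_fcc_*`); the copy-to-type bridge (`…Stack.type_*_of_copy`) supplies the child-type listing.  `F⁻` / `H′` layers: `layer_climb` with
  `kfNeg_fcc` / `e1_entries.2.2`, `up_fccNeg_*` / `up_hcpAlt_*` (R4 instantiates).

Deps: `…CompressedCutStack`, `…KernelStackH`, `…KernelStackF` (the two-parent tables).  No `instance`, no `notation`, no `set_option`, no new axioms, 0 sorry.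
-/

namespace Summit.AtomisticToContinuum.Crystallization.Theorems.OverbindingBudgetAffineCompressedCutStackTwo

open Literature.Geometry.DiscreteGeometry (nearestDist nearestDist_nonneg nearestDist_le_dist fccTwoShellPattern hcpTwoShellPattern
  one_le_dist_of_mem_fccTwoShellPattern one_le_dist_of_mem_hcpTwoShellPattern)
open Summit.AtomisticToContinuum.Crystallization.Theorems.OverbindingBudgetAffineCompressedCutKernel (T3 tsub tadd tsq tdet fccL hcpL fccNegL hcpAltL
  hexL capL kernelOneB kernelTwoB mem_capL fccShellL kf_fcc e1_entries up_hcp_pos_fcc up_hcp_pos_hcp up_hcp_neg_fcc up_hcp_neg_hcp up_fcc_pos_fcc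
  up_fcc_pos_hcp up_fcc_neg_fcc up_fcc_neg_hcp)
open Summit.AtomisticToContinuum.Crystallization.Theorems.OverbindingBudgetAffineCompressedCutCharts (mv Carries ListedBy listedBy_fcc listedBy_hcp)
open Summit.AtomisticToContinuum.Crystallization.Theorems.OverbindingBudgetAffineCompressedCutEstablish (Estab copies_separated link_nonneg)
open Summit.AtomisticToContinuum.Crystallization.Theorems.OverbindingBudgetAffineCompressedCutEstablishTwo (estab_child_two)
open Summit.AtomisticToContinuum.Crystallization.Theorems.OverbindingBudgetAffineCompressedCutSeed (InLayer lnorm hexL_facts hex_descent estab_mono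
  inLayer_tsub inLayer_zero eq_zero_of_lnorm_le tadd_zero_right)
open Summit.AtomisticToContinuum.Crystallization.Theorems.OverbindingBudgetAffineCompressedCutStack (tsub_tadd_tadd tsub_tadd_tadd' tsub_tadd_tadd''
  lnorm_tadd_le lnorm_hex inLayer_tadd copy_eq_of_adjacent type_hcp_of_copy type_fcc_of_copy)

variable {N : ℕ}

/-! ## §0  Tables -/

/-- The four aligned copies have `≤ 18` members and contain the basal hexagon (by `decide`). [this file] -/
theorem copies_basic : ∀ C ∈ [fccL, fccNegL, hcpL, hcpAltL], C.length ≤ 18 ∧ ∀ h ∈ hexL, h ∈ C := by decide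

/-- The basal hexagon consists of first-shell vectors of `F⁺`. [this file] -/
theorem hexL_sub_shell : ∀ h ∈ hexL, h ∈ fccShellL := by decide

/-- **`F⁻` in-layer row**: an fcc child of an `F⁻`-charted site along a basal bond is `F⁻`-charted (kernel-decided). [this file] -/
theorem kfNeg_fcc : kernelOneB fccNegL hexL fccL [fccNegL] = true := by decide +kernel

/-- `(λ + x) − (λ + (x − h)) = h`. [this file] -/
theorem tsub_tadd_tsub (l x h : T3) : tsub (tadd l x) (tadd l (tsub x h)) = h := by
  obtain ⟨a₁, a₂, a₃⟩ := l
  obtain ⟨b₁, b₂, b₃⟩ := x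
  obtain ⟨c₁, c₂, c₃⟩ := h
  simp only [tsub, tadd, Prod.mk.injEq]
  omega

/-! ## §1  One layer up or down -/

/-- ★★ **LAYER CLIMBING.**  See the module docstring.  Inputs: ball data; base-frame lower bound `β`; aligned copy `C`; the listing model `S₁` of every
site charted onto `C` (from `…Stack.type_*_of_copy`); the in-layer one-parent row `kernelOneB C xs S₁ Q1` forcing `C`; the cap configuration
`c₀, c₀ − e₀ ∈ capL C sg`, `e₀ ∈ hexL`, `a₀ ∈ C` adjacent to both with `tdet c₀ e₀ a₀ ≠ 0`; the two-parent rows; the lower disc (hex radius `n + 1`,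
labels `λ₀ + x`, bounds `τ, D`, scales in `[ν, ν′]`); the three resolution inequalities and ROOM.  Output: the adjacent-layer disc of hex radius `n` at
labels `λ₀ + c₀ + x`, bounds `τ⁺, D⁺`, scales in `[0.9967ν, 1.0011ν′]`, copies from the rows. [this file] -/
theorem layer_climb {y : Fin N → EuclideanSpace ℝ (Fin 3)} (hy : Function.Injective y) {r : ℝ} {i : Fin N}
    {A : Fin N → (EuclideanSpace ℝ (Fin 3) →ₗ[ℝ] EuclideanSpace ℝ (Fin 3))} {Qf : Fin N → (EuclideanSpace ℝ (Fin 3) →ₗᵢ[ℝ] EuclideanSpace ℝ (Fin 3))}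
    {P : Fin N → Finset (EuclideanSpace ℝ (Fin 3))} {f : Fin N → EuclideanSpace ℝ (Fin 3) → EuclideanSpace ℝ (Fin 3)}
    {B : EuclideanSpace ℝ (Fin 3) →ₗ[ℝ] EuclideanSpace ℝ (Fin 3)} {β : ℝ}
    (hP : ∀ j, dist (y j) (y i) ≤ r → (P j = fccTwoShellPattern ∨ P j = hcpTwoShellPattern))
    (hA : ∀ j, dist (y j) (y i) ≤ r → ∀ v ∈ P j, ‖A j v - Qf j v‖ ≤ 1 / 1000)
    (hf : ∀ j, dist (y j) (y i) ≤ r → ∀ v ∈ P j, f j v ∈ Set.range y ∧ dist (f j v) (y j + nearestDist y j • A j v) ≤ 1 / 10 ^ 4 * nearestDist y j)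
    (hinj : ∀ j, dist (y j) (y i) ≤ r → Set.InjOn (f j) ↑(P j))
    (hex : ∀ j, dist (y j) (y i) ≤ r → ∀ m, m ≠ j → dist (y m) (y j) ≤ (3 / 2 + 1 / 450) * nearestDist y j → ∃ v ∈ P j, f j v = y m)
    (hB : ∀ z, β * ‖z‖ ≤ ‖B z‖)
    {C : List T3} (hC : C ∈ [fccL, fccNegL, hcpL, hcpAltL]) {S₁ : List T3} (hS₁ : S₁ = fccL ∨ S₁ = hcpL)
    (hT : ∀ k, dist (y k) (y i) ≤ r → ∀ (M : EuclideanSpace ℝ (Fin 3) →ₗᵢ[ℝ] EuclideanSpace ℝ (Fin 3)) (lam : T3) (τ D : ℝ),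
      Estab y A P B i k M C lam τ D → ListedBy (P k) S₁)
    {xs : List T3} (hxs : ∀ h ∈ hexL, h ∈ xs) {Q1 : List (List T3)} (hK1 : kernelOneB C xs S₁ Q1 = true) (hQ1 : ∀ Q ∈ Q1, Q = C)
    {sg : ℤ} {c₀ e₀ a₀ : T3} (hc₀ : c₀ ∈ capL C sg) (hc₀e : tsub c₀ e₀ ∈ capL C sg) (he₀ : e₀ ∈ hexL)
    (ha₀ : a₀ ∈ C) (hax : tsq (tsub a₀ c₀) = 18) (hae : tsq (tsub a₀ e₀) = 18) (hdet : tdet c₀ e₀ a₀ ≠ 0)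
    {Q2f Q2h : List (List T3)} (hK2f : kernelTwoB C sg fccL Q2f = true) (hK2h : kernelTwoB C sg hcpL Q2h = true)
    (hl2f : ∀ Q ∈ Q2f, Q.length ≤ 18) (hl2h : ∀ Q ∈ Q2h, Q.length ≤ 18)
    {lam₀ : T3} {τ D ν ν' : ℝ} {n : ℕ}
    (hdisc : ∀ x, InLayer x → lnorm x ≤ 6 * ((n : ℤ) + 1) → ∃ k : Fin N, ∃ M : EuclideanSpace ℝ (Fin 3) →ₗᵢ[ℝ] EuclideanSpace ℝ (Fin 3),
      dist (y k) (y i) ≤ r ∧ ν ≤ nearestDist y k ∧ nearestDist y k ≤ ν' ∧ Estab y A P B i k M C (tadd lam₀ x) τ D)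
    (hΔ : 2 * D + 1 / 10 ^ 4 * ν' + τ < ν) (hsmall : (2 * τ + 5 / 2 * (3 / 10 ^ 4 * ν')) * Real.sqrt 2 < β)
    (hΔk : 2 * D + 2 / 10 ^ 4 * ν' + 2 * τ < 9967 / 10000 * ν)
    (hroom : ∀ x, InLayer x → lnorm x ≤ 6 * (n : ℤ) → ‖B (mv (tadd (tadd lam₀ c₀) x))‖ + (D + 1 / 10 ^ 4 * ν' + τ) ≤ r) :
    ∀ x, InLayer x → lnorm x ≤ 6 * (n : ℤ) → ∃ k : Fin N, ∃ M : EuclideanSpace ℝ (Fin 3) →ₗᵢ[ℝ] EuclideanSpace ℝ (Fin 3), ∃ Q : List T3,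
      dist (y k) (y i) ≤ r ∧ 9967 / 10000 * ν ≤ nearestDist y k ∧ nearestDist y k ≤ 10011 / 10000 * ν' ∧
      ((P k = fccTwoShellPattern ∧ Q ∈ Q2f) ∨ (P k = hcpTwoShellPattern ∧ Q ∈ Q2h)) ∧
      Estab y A P B i k M Q (tadd (tadd lam₀ c₀) x) (τ + 5 / 2 * (2 * (1 / 10 ^ 4) * ν' + 1 / 10 ^ 4 * (10011 / 10000 * ν')))
        (D + 1 / 10 ^ 4 * ν' + τ) := by
  intro x hx hl
  obtain ⟨hClen, hhexC⟩ := copies_basic C hC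
  have hsep := copies_separated C hC
  obtain ⟨he₀L, he₀18⟩ := hexL_facts e₀ he₀
  have hl1 : lnorm x ≤ 6 * ((n : ℤ) + 1) := by linarith
  have hl2 : lnorm (tadd x e₀) ≤ 6 * ((n : ℤ) + 1) := by
    have h := lnorm_tadd_le x e₀
    rw [lnorm_hex e₀ he₀] at h
    linarith
  obtain ⟨j₁, M₁, hj₁, hν₁, hν₁', hE₁⟩ := hdisc x hx hl1
  obtain ⟨j₂, M₂, hj₂, hν₂, hν₂', hE₂⟩ := hdisc (tadd x e₀) (inLayer_tadd hx he₀L) hl2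
  have hed : tsub (tadd lam₀ (tadd x e₀)) (tadd lam₀ x) = e₀ := tsub_tadd_tadd lam₀ x e₀
  have hq1 : tsub (tadd (tadd lam₀ c₀) x) (tadd lam₀ x) = c₀ := tsub_tadd_tadd' lam₀ c₀ x
  have hq2 : tsub (tadd (tadd lam₀ c₀) x) (tadd lam₀ (tadd x e₀)) = tsub c₀ e₀ := tsub_tadd_tadd'' lam₀ c₀ x e₀
  have hL₂ : ListedBy (P j₂) S₁ := hT j₂ hj₂ M₂ _ _ _ hE₂
  have hτ0 : 0 ≤ τ := link_nonneg hE₁.2.1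
  have c1 : (D + 1 / 10 ^ 4 * nearestDist y j₁ + τ) + D < nearestDist y j₂ := by linarith
  have c2 : (τ + 5 / 2 * (2 * (1 / 10 ^ 4) * nearestDist y j₁ + 1 / 10 ^ 4 * nearestDist y j₂) + τ) * Real.sqrt 2 < β := by
    have h1 : τ + 5 / 2 * (2 * (1 / 10 ^ 4) * nearestDist y j₁ + 1 / 10 ^ 4 * nearestDist y j₂) + τ ≤ 2 * τ + 5 / 2 * (3 / 10 ^ 4 * ν') := by
      linarith
    have h2 := mul_le_mul_of_nonneg_right h1 (Real.sqrt_nonneg 2)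
    linarith
  have c3 : (D + 1 / 10 ^ 4 * nearestDist y j₁ + τ) + (D + 1 / 10 ^ 4 * nearestDist y j₂ + τ) < 9967 / 10000 * nearestDist y j₁ := by linarith
  have c4 : ‖B (mv (tadd (tadd lam₀ c₀) x))‖ + (D + 1 / 10 ^ 4 * nearestDist y j₁ + τ) ≤ r := by
    have h := hroom x hx hl
    linarith
  obtain ⟨k, v, -, -, -, -, hkr, hsc, hsc', R₁, -, Q, hQ, hEk⟩ :=
    estab_child_two hy hP hA hf hinj hex hj₁ hj₂ hB hE₁ hE₂ hsep hClen (by rw [hed]; exact hhexC e₀ he₀) (by rw [hed]; exact he₀18)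
      (xs := xs) (by rw [hed]; exact hxs e₀ he₀) hS₁ hL₂ hK1 hQ1 c1 c2
      (q := tadd (tadd lam₀ c₀) x) (sg := sg) (by rw [hq1]; exact hc₀) (by rw [hq2]; exact hc₀e)
      (a := a₀) ha₀ (by rw [hq1]; exact hax) (by rw [hed]; exact hae) (by rw [hq1, hed]; exact hdet) hK2f hK2h hl2f hl2h c3 c4
  refine ⟨k, M₁.comp R₁, Q, hkr, by linarith, by linarith, hQ, estab_mono hEk ?_ ?_⟩
  · have h : nearestDist y k ≤ 10011 / 10000 * ν' := by linarith
    linarith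
  · linarith

/-! ## §2  Uniformisation of the copy over a disc (class recursion) -/

/-- ★ **ONE COPY PER LAYER DISC.**  If every point of a layer disc (hex radius `n`, labels `λ₁ + x`) is the label of an established site charted onto SOME
aligned copy (bounds `τ, D`, scales in `[ν, ν′]`), then one aligned copy serves for all of them — adjacent points force equal copies
(`…Stack.copy_eq_of_adjacent`) and the disc is hex-connected to its centre (`…Seed.hex_descent`). [this file] -/
theorem disc_uniform {y : Fin N → EuclideanSpace ℝ (Fin 3)} {r : ℝ} {i : Fin N}
    {A : Fin N → (EuclideanSpace ℝ (Fin 3) →ₗ[ℝ] EuclideanSpace ℝ (Fin 3))} {P : Fin N → Finset (EuclideanSpace ℝ (Fin 3))}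
    {f : Fin N → EuclideanSpace ℝ (Fin 3) → EuclideanSpace ℝ (Fin 3)} {B : EuclideanSpace ℝ (Fin 3) →ₗ[ℝ] EuclideanSpace ℝ (Fin 3)} {β γ : ℝ}
    (hP : ∀ j, dist (y j) (y i) ≤ r → (P j = fccTwoShellPattern ∨ P j = hcpTwoShellPattern))
    (hf : ∀ j, dist (y j) (y i) ≤ r → ∀ v ∈ P j, f j v ∈ Set.range y ∧ dist (f j v) (y j + nearestDist y j • A j v) ≤ 1 / 10 ^ 4 * nearestDist y j)
    (hex : ∀ j, dist (y j) (y i) ≤ r → ∀ m, m ≠ j → dist (y m) (y j) ≤ (3 / 2 + 1 / 450) * nearestDist y j → ∃ v ∈ P j, f j v = y m)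
    (hB : ∀ z, β * ‖z‖ ≤ ‖B z‖) (hβ : 0 < β) (hBup : ∀ z, ‖B z‖ ≤ γ * ‖z‖)
    {lam₁ : T3} {τ D ν ν' : ℝ} {n : ℕ}
    (hdisc : ∀ x, InLayer x → lnorm x ≤ 6 * (n : ℤ) → ∃ k : Fin N, ∃ M : EuclideanSpace ℝ (Fin 3) →ₗᵢ[ℝ] EuclideanSpace ℝ (Fin 3), ∃ Q : List T3,
      dist (y k) (y i) ≤ r ∧ ν ≤ nearestDist y k ∧ nearestDist y k ≤ ν' ∧ Q ∈ [fccL, fccNegL, hcpL, hcpAltL] ∧ Estab y A P B i k M Q (tadd lam₁ x) τ D)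
    (hreach : γ + (D + 1 / 10 ^ 4 * ν' + τ) + D ≤ (3 / 2 + 1 / 450) * ν)
    (hgap : 18 * ((D + 1 / 10 ^ 4 * ν' + τ) + (D + 1 / 10 ^ 4 * ν' + Real.sqrt 2 * τ)) ^ 2 < 6 * β ^ 2) :
    ∃ C ∈ [fccL, fccNegL, hcpL, hcpAltL], ∀ x, InLayer x → lnorm x ≤ 6 * (n : ℤ) →
      ∃ k : Fin N, ∃ M : EuclideanSpace ℝ (Fin 3) →ₗᵢ[ℝ] EuclideanSpace ℝ (Fin 3),
        dist (y k) (y i) ≤ r ∧ ν ≤ nearestDist y k ∧ nearestDist y k ≤ ν' ∧ Estab y A P B i k M C (tadd lam₁ x) τ D := by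
  have hl0 : lnorm (0, 0, 0) ≤ 6 * (n : ℤ) := by
    have h : lnorm (0, 0, 0) = 0 := by decide
    rw [h]
    positivity
  obtain ⟨k₀, M₀, C, hk₀, hν₀, hν₀', hC, hE₀⟩ := hdisc (0, 0, 0) inLayer_zero hl0
  rw [tadd_zero_right] at hE₀
  refine ⟨C, hC, ?_⟩
  suffices h : ∀ d : ℕ, ∀ x, InLayer x → lnorm x ≤ 6 * (d : ℤ) → lnorm x ≤ 6 * (n : ℤ) →
      ∃ k : Fin N, ∃ M : EuclideanSpace ℝ (Fin 3) →ₗᵢ[ℝ] EuclideanSpace ℝ (Fin 3),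
        dist (y k) (y i) ≤ r ∧ ν ≤ nearestDist y k ∧ nearestDist y k ≤ ν' ∧ Estab y A P B i k M C (tadd lam₁ x) τ D by
    intro x hx hl
    exact h n x hx hl hl
  intro d
  induction d with
  | zero =>
    intro x hx hl _
    have hx0 : x = (0, 0, 0) := eq_zero_of_lnorm_le x (by simpa using hl)
    rw [hx0, tadd_zero_right]
    exact ⟨k₀, M₀, hk₀, hν₀, hν₀', hE₀⟩
  | succ d ih =>
    intro x hx hl hln
    by_cases hx0 : x = (0, 0, 0)
    · rw [hx0, tadd_zero_right]
      exact ⟨k₀, M₀, hk₀, hν₀, hν₀', hE₀⟩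
    obtain ⟨h, hh, hdesc⟩ := hex_descent hx hx0
    have hxh : InLayer (tsub x h) := inLayer_tsub hx (hexL_facts h hh).1
    have hl' : lnorm (tsub x h) ≤ 6 * (d : ℤ) := by
      push_cast at hl
      linarith
    have hln' : lnorm (tsub x h) ≤ 6 * (n : ℤ) := by linarith
    obtain ⟨j, M, hj, hνj, hνj', hEj⟩ := ih (tsub x h) hxh hl' hln'
    obtain ⟨j', M', C', hj', hνj'', hνj''', hC', hEj'⟩ := hdisc x hx hln
    have he : tsub (tadd lam₁ x) (tadd lam₁ (tsub x h)) = h := tsub_tadd_tsub lam₁ x h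
    have hD0 : 0 ≤ D := (norm_nonneg _).trans hEj.2.2
    have hτ0 : 0 ≤ τ := link_nonneg hEj.2.1
    have hnnj := nearestDist_nonneg y j
    have hnnj' := nearestDist_nonneg y j'
    have hst : 0 ≤ Real.sqrt 2 * τ := mul_nonneg (Real.sqrt_nonneg 2) hτ0
    have hreach' : γ + (D + 1 / 10 ^ 4 * nearestDist y j + τ) + D ≤ (3 / 2 + 1 / 450) * nearestDist y j' := by linarith
    have hS0 : 0 ≤ (D + 1 / 10 ^ 4 * nearestDist y j + τ) + (D + 1 / 10 ^ 4 * nearestDist y j' + Real.sqrt 2 * τ) := by linarith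
    have hle : (D + 1 / 10 ^ 4 * nearestDist y j + τ) + (D + 1 / 10 ^ 4 * nearestDist y j' + Real.sqrt 2 * τ) ≤
        (D + 1 / 10 ^ 4 * ν' + τ) + (D + 1 / 10 ^ 4 * ν' + Real.sqrt 2 * τ) := by linarith
    have hsq : ((D + 1 / 10 ^ 4 * nearestDist y j + τ) + (D + 1 / 10 ^ 4 * nearestDist y j' + Real.sqrt 2 * τ)) ^ 2 ≤
        ((D + 1 / 10 ^ 4 * ν' + τ) + (D + 1 / 10 ^ 4 * ν' + Real.sqrt 2 * τ)) ^ 2 := by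
      rw [pow_two, pow_two]
      exact mul_le_mul hle hle hS0 (hS0.trans hle)
    have hgap' : 18 * ((D + 1 / 10 ^ 4 * nearestDist y j + τ) + (D + 1 / 10 ^ 4 * nearestDist y j' + Real.sqrt 2 * τ)) ^ 2 < 6 * β ^ 2 := by
      linarith
    have hCC : C' = C := copy_eq_of_adjacent hP hf hex hj hj' hB hβ hBup hEj hEj' hC hC' (by rw [he]; exact hh) hreach' hgap'
    rw [hCC] at hEj'
    exact ⟨j', M', hj', hνj'', hνj''', hEj'⟩

/-! ## §3  Record instances -/

/-- **Up from an `H` layer** (`sg = 1`, caps `(3,3,0)`-type; rows E1 and `up_hcp_pos_*`): fcc children charted onto `F⁺`, hcp children onto `H′`.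
[this file] -/
theorem climb_hcp_up {y : Fin N → EuclideanSpace ℝ (Fin 3)} (hy : Function.Injective y) {r : ℝ} {i : Fin N}
    {A : Fin N → (EuclideanSpace ℝ (Fin 3) →ₗ[ℝ] EuclideanSpace ℝ (Fin 3))} {Qf : Fin N → (EuclideanSpace ℝ (Fin 3) →ₗᵢ[ℝ] EuclideanSpace ℝ (Fin 3))}
    {P : Fin N → Finset (EuclideanSpace ℝ (Fin 3))} {f : Fin N → EuclideanSpace ℝ (Fin 3) → EuclideanSpace ℝ (Fin 3)}
    {B : EuclideanSpace ℝ (Fin 3) →ₗ[ℝ] EuclideanSpace ℝ (Fin 3)} {β : ℝ}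
    (hP : ∀ j, dist (y j) (y i) ≤ r → (P j = fccTwoShellPattern ∨ P j = hcpTwoShellPattern))
    (hA : ∀ j, dist (y j) (y i) ≤ r → ∀ v ∈ P j, ‖A j v - Qf j v‖ ≤ 1 / 1000)
    (hf : ∀ j, dist (y j) (y i) ≤ r → ∀ v ∈ P j, f j v ∈ Set.range y ∧ dist (f j v) (y j + nearestDist y j • A j v) ≤ 1 / 10 ^ 4 * nearestDist y j)
    (hinj : ∀ j, dist (y j) (y i) ≤ r → Set.InjOn (f j) ↑(P j))
    (hex : ∀ j, dist (y j) (y i) ≤ r → ∀ m, m ≠ j → dist (y m) (y j) ≤ (3 / 2 + 1 / 450) * nearestDist y j → ∃ v ∈ P j, f j v = y m)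
    (hB : ∀ z, β * ‖z‖ ≤ ‖B z‖) {lam₀ : T3} {τ D ν ν' : ℝ} {n : ℕ}
    (hdisc : ∀ x, InLayer x → lnorm x ≤ 6 * ((n : ℤ) + 1) → ∃ k : Fin N, ∃ M : EuclideanSpace ℝ (Fin 3) →ₗᵢ[ℝ] EuclideanSpace ℝ (Fin 3),
      dist (y k) (y i) ≤ r ∧ ν ≤ nearestDist y k ∧ nearestDist y k ≤ ν' ∧ Estab y A P B i k M hcpL (tadd lam₀ x) τ D)
    (hΔ : 2 * D + 1 / 10 ^ 4 * ν' + τ < ν) (hsmall : (2 * τ + 5 / 2 * (3 / 10 ^ 4 * ν')) * Real.sqrt 2 < β)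
    (hΔk : 2 * D + 2 / 10 ^ 4 * ν' + 2 * τ < 9967 / 10000 * ν)
    (hroom : ∀ x, InLayer x → lnorm x ≤ 6 * (n : ℤ) → ‖B (mv (tadd (tadd lam₀ (3, 3, 0)) x))‖ + (D + 1 / 10 ^ 4 * ν' + τ) ≤ r) :
    ∀ x, InLayer x → lnorm x ≤ 6 * (n : ℤ) → ∃ k : Fin N, ∃ M : EuclideanSpace ℝ (Fin 3) →ₗᵢ[ℝ] EuclideanSpace ℝ (Fin 3), ∃ Q : List T3,
      dist (y k) (y i) ≤ r ∧ 9967 / 10000 * ν ≤ nearestDist y k ∧ nearestDist y k ≤ 10011 / 10000 * ν' ∧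
      ((P k = fccTwoShellPattern ∧ Q ∈ [fccL]) ∨ (P k = hcpTwoShellPattern ∧ Q ∈ [hcpAltL])) ∧
      Estab y A P B i k M Q (tadd (tadd lam₀ (3, 3, 0)) x) (τ + 5 / 2 * (2 * (1 / 10 ^ 4) * ν' + 1 / 10 ^ 4 * (10011 / 10000 * ν')))
        (D + 1 / 10 ^ 4 * ν' + τ) :=
  layer_climb hy hP hA hf hinj hex hB (C := hcpL) (by simp) (S₁ := hcpL) (Or.inr rfl)
    (fun k hk M lam τ D hE => by rw [type_hcp_of_copy (hP k hk) (Or.inl rfl) hE.1]; exact listedBy_hcp)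
    (xs := hexL) (fun h hh => hh) e1_entries.2.1 (by simp) (sg := 1) (c₀ := (3, 3, 0)) (e₀ := (0, 3, -3)) (a₀ := (3, 0, -3))
    (by decide) (by decide) (by decide) (by decide) (by decide) (by decide) (by decide)
    up_hcp_pos_fcc up_hcp_pos_hcp (by decide) (by decide) hdisc hΔ hsmall hΔk hroom

/-- **Down from an `H` layer** (`sg = −1`, caps `(−1,−1,−4)`-type; rows E1 and `up_hcp_neg_*`): fcc children onto `F⁻`, hcp children onto `H′`. [this file] -/
theorem climb_hcp_down {y : Fin N → EuclideanSpace ℝ (Fin 3)} (hy : Function.Injective y) {r : ℝ} {i : Fin N}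
    {A : Fin N → (EuclideanSpace ℝ (Fin 3) →ₗ[ℝ] EuclideanSpace ℝ (Fin 3))} {Qf : Fin N → (EuclideanSpace ℝ (Fin 3) →ₗᵢ[ℝ] EuclideanSpace ℝ (Fin 3))}
    {P : Fin N → Finset (EuclideanSpace ℝ (Fin 3))} {f : Fin N → EuclideanSpace ℝ (Fin 3) → EuclideanSpace ℝ (Fin 3)}
    {B : EuclideanSpace ℝ (Fin 3) →ₗ[ℝ] EuclideanSpace ℝ (Fin 3)} {β : ℝ}
    (hP : ∀ j, dist (y j) (y i) ≤ r → (P j = fccTwoShellPattern ∨ P j = hcpTwoShellPattern))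
    (hA : ∀ j, dist (y j) (y i) ≤ r → ∀ v ∈ P j, ‖A j v - Qf j v‖ ≤ 1 / 1000)
    (hf : ∀ j, dist (y j) (y i) ≤ r → ∀ v ∈ P j, f j v ∈ Set.range y ∧ dist (f j v) (y j + nearestDist y j • A j v) ≤ 1 / 10 ^ 4 * nearestDist y j)
    (hinj : ∀ j, dist (y j) (y i) ≤ r → Set.InjOn (f j) ↑(P j))
    (hex : ∀ j, dist (y j) (y i) ≤ r → ∀ m, m ≠ j → dist (y m) (y j) ≤ (3 / 2 + 1 / 450) * nearestDist y j → ∃ v ∈ P j, f j v = y m)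
    (hB : ∀ z, β * ‖z‖ ≤ ‖B z‖) {lam₀ : T3} {τ D ν ν' : ℝ} {n : ℕ}
    (hdisc : ∀ x, InLayer x → lnorm x ≤ 6 * ((n : ℤ) + 1) → ∃ k : Fin N, ∃ M : EuclideanSpace ℝ (Fin 3) →ₗᵢ[ℝ] EuclideanSpace ℝ (Fin 3),
      dist (y k) (y i) ≤ r ∧ ν ≤ nearestDist y k ∧ nearestDist y k ≤ ν' ∧ Estab y A P B i k M hcpL (tadd lam₀ x) τ D)
    (hΔ : 2 * D + 1 / 10 ^ 4 * ν' + τ < ν) (hsmall : (2 * τ + 5 / 2 * (3 / 10 ^ 4 * ν')) * Real.sqrt 2 < β)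
    (hΔk : 2 * D + 2 / 10 ^ 4 * ν' + 2 * τ < 9967 / 10000 * ν)
    (hroom : ∀ x, InLayer x → lnorm x ≤ 6 * (n : ℤ) → ‖B (mv (tadd (tadd lam₀ (-1, -1, -4)) x))‖ + (D + 1 / 10 ^ 4 * ν' + τ) ≤ r) :
    ∀ x, InLayer x → lnorm x ≤ 6 * (n : ℤ) → ∃ k : Fin N, ∃ M : EuclideanSpace ℝ (Fin 3) →ₗᵢ[ℝ] EuclideanSpace ℝ (Fin 3), ∃ Q : List T3,
      dist (y k) (y i) ≤ r ∧ 9967 / 10000 * ν ≤ nearestDist y k ∧ nearestDist y k ≤ 10011 / 10000 * ν' ∧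
      ((P k = fccTwoShellPattern ∧ Q ∈ [fccNegL]) ∨ (P k = hcpTwoShellPattern ∧ Q ∈ [hcpAltL])) ∧
      Estab y A P B i k M Q (tadd (tadd lam₀ (-1, -1, -4)) x) (τ + 5 / 2 * (2 * (1 / 10 ^ 4) * ν' + 1 / 10 ^ 4 * (10011 / 10000 * ν')))
        (D + 1 / 10 ^ 4 * ν' + τ) :=
  layer_climb hy hP hA hf hinj hex hB (C := hcpL) (by simp) (S₁ := hcpL) (Or.inr rfl)
    (fun k hk M lam τ D hE => by rw [type_hcp_of_copy (hP k hk) (Or.inl rfl) hE.1]; exact listedBy_hcp)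
    (xs := hexL) (fun h hh => hh) e1_entries.2.1 (by simp) (sg := -1) (c₀ := (-1, -1, -4)) (e₀ := (0, 3, -3)) (a₀ := (3, 0, -3))
    (by decide) (by decide) (by decide) (by decide) (by decide) (by decide) (by decide)
    up_hcp_neg_fcc up_hcp_neg_hcp (by decide) (by decide) hdisc hΔ hsmall hΔk hroom

/-- **Up from an `F⁺` layer** (`sg = 1`, caps `(3,3,0)`-type; rows KF and `up_fcc_pos_*`): fcc children onto `F⁺`, hcp children onto `H′`. [this file] -/
theorem climb_fcc_up {y : Fin N → EuclideanSpace ℝ (Fin 3)} (hy : Function.Injective y) {r : ℝ} {i : Fin N}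
    {A : Fin N → (EuclideanSpace ℝ (Fin 3) →ₗ[ℝ] EuclideanSpace ℝ (Fin 3))} {Qf : Fin N → (EuclideanSpace ℝ (Fin 3) →ₗᵢ[ℝ] EuclideanSpace ℝ (Fin 3))}
    {P : Fin N → Finset (EuclideanSpace ℝ (Fin 3))} {f : Fin N → EuclideanSpace ℝ (Fin 3) → EuclideanSpace ℝ (Fin 3)}
    {B : EuclideanSpace ℝ (Fin 3) →ₗ[ℝ] EuclideanSpace ℝ (Fin 3)} {β : ℝ}
    (hP : ∀ j, dist (y j) (y i) ≤ r → (P j = fccTwoShellPattern ∨ P j = hcpTwoShellPattern))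
    (hA : ∀ j, dist (y j) (y i) ≤ r → ∀ v ∈ P j, ‖A j v - Qf j v‖ ≤ 1 / 1000)
    (hf : ∀ j, dist (y j) (y i) ≤ r → ∀ v ∈ P j, f j v ∈ Set.range y ∧ dist (f j v) (y j + nearestDist y j • A j v) ≤ 1 / 10 ^ 4 * nearestDist y j)
    (hinj : ∀ j, dist (y j) (y i) ≤ r → Set.InjOn (f j) ↑(P j))
    (hex : ∀ j, dist (y j) (y i) ≤ r → ∀ m, m ≠ j → dist (y m) (y j) ≤ (3 / 2 + 1 / 450) * nearestDist y j → ∃ v ∈ P j, f j v = y m)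
    (hB : ∀ z, β * ‖z‖ ≤ ‖B z‖) {lam₀ : T3} {τ D ν ν' : ℝ} {n : ℕ}
    (hdisc : ∀ x, InLayer x → lnorm x ≤ 6 * ((n : ℤ) + 1) → ∃ k : Fin N, ∃ M : EuclideanSpace ℝ (Fin 3) →ₗᵢ[ℝ] EuclideanSpace ℝ (Fin 3),
      dist (y k) (y i) ≤ r ∧ ν ≤ nearestDist y k ∧ nearestDist y k ≤ ν' ∧ Estab y A P B i k M fccL (tadd lam₀ x) τ D)
    (hΔ : 2 * D + 1 / 10 ^ 4 * ν' + τ < ν) (hsmall : (2 * τ + 5 / 2 * (3 / 10 ^ 4 * ν')) * Real.sqrt 2 < β)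
    (hΔk : 2 * D + 2 / 10 ^ 4 * ν' + 2 * τ < 9967 / 10000 * ν)
    (hroom : ∀ x, InLayer x → lnorm x ≤ 6 * (n : ℤ) → ‖B (mv (tadd (tadd lam₀ (3, 3, 0)) x))‖ + (D + 1 / 10 ^ 4 * ν' + τ) ≤ r) :
    ∀ x, InLayer x → lnorm x ≤ 6 * (n : ℤ) → ∃ k : Fin N, ∃ M : EuclideanSpace ℝ (Fin 3) →ₗᵢ[ℝ] EuclideanSpace ℝ (Fin 3), ∃ Q : List T3,
      dist (y k) (y i) ≤ r ∧ 9967 / 10000 * ν ≤ nearestDist y k ∧ nearestDist y k ≤ 10011 / 10000 * ν' ∧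
      ((P k = fccTwoShellPattern ∧ Q ∈ [fccL]) ∨ (P k = hcpTwoShellPattern ∧ Q ∈ [hcpAltL])) ∧
      Estab y A P B i k M Q (tadd (tadd lam₀ (3, 3, 0)) x) (τ + 5 / 2 * (2 * (1 / 10 ^ 4) * ν' + 1 / 10 ^ 4 * (10011 / 10000 * ν')))
        (D + 1 / 10 ^ 4 * ν' + τ) :=
  layer_climb hy hP hA hf hinj hex hB (C := fccL) (by simp) (S₁ := fccL) (Or.inl rfl)
    (fun k hk M lam τ D hE => by rw [type_fcc_of_copy (hP k hk) (Or.inl rfl) hE.1]; exact listedBy_fcc)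
    (xs := fccShellL) hexL_sub_shell kf_fcc (by simp) (sg := 1) (c₀ := (3, 3, 0)) (e₀ := (0, 3, -3)) (a₀ := (3, 0, -3))
    (by decide) (by decide) (by decide) (by decide) (by decide) (by decide) (by decide)
    up_fcc_pos_fcc up_fcc_pos_hcp (by decide) (by decide) hdisc hΔ hsmall hΔk hroom

/-- **Down from an `F⁺` layer** (`sg = −1`, caps `(−3,−3,0)`-type; rows KF and `up_fcc_neg_*`): fcc children onto `F⁺`, hcp children onto `H`. [this file] -/
theorem climb_fcc_down {y : Fin N → EuclideanSpace ℝ (Fin 3)} (hy : Function.Injective y) {r : ℝ} {i : Fin N}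
    {A : Fin N → (EuclideanSpace ℝ (Fin 3) →ₗ[ℝ] EuclideanSpace ℝ (Fin 3))} {Qf : Fin N → (EuclideanSpace ℝ (Fin 3) →ₗᵢ[ℝ] EuclideanSpace ℝ (Fin 3))}
    {P : Fin N → Finset (EuclideanSpace ℝ (Fin 3))} {f : Fin N → EuclideanSpace ℝ (Fin 3) → EuclideanSpace ℝ (Fin 3)}
    {B : EuclideanSpace ℝ (Fin 3) →ₗ[ℝ] EuclideanSpace ℝ (Fin 3)} {β : ℝ}
    (hP : ∀ j, dist (y j) (y i) ≤ r → (P j = fccTwoShellPattern ∨ P j = hcpTwoShellPattern))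
    (hA : ∀ j, dist (y j) (y i) ≤ r → ∀ v ∈ P j, ‖A j v - Qf j v‖ ≤ 1 / 1000)
    (hf : ∀ j, dist (y j) (y i) ≤ r → ∀ v ∈ P j, f j v ∈ Set.range y ∧ dist (f j v) (y j + nearestDist y j • A j v) ≤ 1 / 10 ^ 4 * nearestDist y j)
    (hinj : ∀ j, dist (y j) (y i) ≤ r → Set.InjOn (f j) ↑(P j))
    (hex : ∀ j, dist (y j) (y i) ≤ r → ∀ m, m ≠ j → dist (y m) (y j) ≤ (3 / 2 + 1 / 450) * nearestDist y j → ∃ v ∈ P j, f j v = y m)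
    (hB : ∀ z, β * ‖z‖ ≤ ‖B z‖) {lam₀ : T3} {τ D ν ν' : ℝ} {n : ℕ}
    (hdisc : ∀ x, InLayer x → lnorm x ≤ 6 * ((n : ℤ) + 1) → ∃ k : Fin N, ∃ M : EuclideanSpace ℝ (Fin 3) →ₗᵢ[ℝ] EuclideanSpace ℝ (Fin 3),
      dist (y k) (y i) ≤ r ∧ ν ≤ nearestDist y k ∧ nearestDist y k ≤ ν' ∧ Estab y A P B i k M fccL (tadd lam₀ x) τ D)
    (hΔ : 2 * D + 1 / 10 ^ 4 * ν' + τ < ν) (hsmall : (2 * τ + 5 / 2 * (3 / 10 ^ 4 * ν')) * Real.sqrt 2 < β)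
    (hΔk : 2 * D + 2 / 10 ^ 4 * ν' + 2 * τ < 9967 / 10000 * ν)
    (hroom : ∀ x, InLayer x → lnorm x ≤ 6 * (n : ℤ) → ‖B (mv (tadd (tadd lam₀ (-3, -3, 0)) x))‖ + (D + 1 / 10 ^ 4 * ν' + τ) ≤ r) :
    ∀ x, InLayer x → lnorm x ≤ 6 * (n : ℤ) → ∃ k : Fin N, ∃ M : EuclideanSpace ℝ (Fin 3) →ₗᵢ[ℝ] EuclideanSpace ℝ (Fin 3), ∃ Q : List T3,
      dist (y k) (y i) ≤ r ∧ 9967 / 10000 * ν ≤ nearestDist y k ∧ nearestDist y k ≤ 10011 / 10000 * ν' ∧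
      ((P k = fccTwoShellPattern ∧ Q ∈ [fccL]) ∨ (P k = hcpTwoShellPattern ∧ Q ∈ [hcpL])) ∧
      Estab y A P B i k M Q (tadd (tadd lam₀ (-3, -3, 0)) x) (τ + 5 / 2 * (2 * (1 / 10 ^ 4) * ν' + 1 / 10 ^ 4 * (10011 / 10000 * ν')))
        (D + 1 / 10 ^ 4 * ν' + τ) :=
  layer_climb hy hP hA hf hinj hex hB (C := fccL) (by simp) (S₁ := fccL) (Or.inl rfl)
    (fun k hk M lam τ D hE => by rw [type_fcc_of_copy (hP k hk) (Or.inl rfl) hE.1]; exact listedBy_fcc)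
    (xs := fccShellL) hexL_sub_shell kf_fcc (by simp) (sg := -1) (c₀ := (-3, -3, 0)) (e₀ := (0, -3, 3)) (a₀ := (-3, 0, 3))
    (by decide) (by decide) (by decide) (by decide) (by decide) (by decide) (by decide)
    up_fcc_neg_fcc up_fcc_neg_hcp (by decide) (by decide) hdisc hΔ hsmall hΔk hroom

/-! ## §4  (O9) Injectivity of the neighbour field -/

/-- **(O9) DISCHARGED for framed sites**: a neighbour field within `10⁻⁴·nn` of `y_j + nn·A v`, `A` within `1/1000` of an isometry on the
pattern, `nn > 0`, is injective on the pattern — distinct pattern points are `1`-separated [Literature `one_le_dist_of_mem_fcc/hcpTwoShellPattern`],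
so their predicted images are `≥ (1 − 2/1000)·nn` apart, more than the two tolerances `2·10⁻⁴·nn`. [this file] -/
theorem injOn_of_field {y : Fin N → EuclideanSpace ℝ (Fin 3)} {j : Fin N} {P : Finset (EuclideanSpace ℝ (Fin 3))}
    {A : EuclideanSpace ℝ (Fin 3) →ₗ[ℝ] EuclideanSpace ℝ (Fin 3)} {Qf : EuclideanSpace ℝ (Fin 3) →ₗᵢ[ℝ] EuclideanSpace ℝ (Fin 3)}
    {f : EuclideanSpace ℝ (Fin 3) → EuclideanSpace ℝ (Fin 3)}
    (hP : P = fccTwoShellPattern ∨ P = hcpTwoShellPattern) (hA : ∀ v ∈ P, ‖A v - Qf v‖ ≤ 1 / 1000)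
    (hf : ∀ v ∈ P, dist (f v) (y j + nearestDist y j • A v) ≤ 1 / 10 ^ 4 * nearestDist y j) (hpos : 0 < nearestDist y j) :
    Set.InjOn f ↑P := by
  intro v hv w hw hvw
  by_contra hne
  have hv' : v ∈ P := hv
  have hw' : w ∈ P := hw
  have h1 : 1 ≤ ‖v - w‖ := by
    rw [← dist_eq_norm]
    rcases hP with rfl | rfl
    · exact one_le_dist_of_mem_fccTwoShellPattern hv' hw' hne
    · exact one_le_dist_of_mem_hcpTwoShellPattern hv' hw' hne
  have hQ : ‖Qf v - Qf w‖ = ‖v - w‖ := by rw [← map_sub, Qf.norm_map]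
  have hAvw : ‖v - w‖ - 2 / 1000 ≤ ‖A v - A w‖ := by
    have e : Qf v - Qf w = (A v - A w) - ((A v - Qf v) - (A w - Qf w)) := by abel
    have h2 : ‖Qf v - Qf w‖ ≤ ‖A v - A w‖ + ‖(A v - Qf v) - (A w - Qf w)‖ := by
      rw [e]
      exact norm_sub_le _ _
    have h3 : ‖(A v - Qf v) - (A w - Qf w)‖ ≤ ‖A v - Qf v‖ + ‖A w - Qf w‖ := norm_sub_le _ _
    linarith [hA v hv', hA w hw']
  have hpred : dist (y j + nearestDist y j • A v) (y j + nearestDist y j • A w) = nearestDist y j * ‖A v - A w‖ := by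
    rw [dist_eq_norm, add_sub_add_left_eq_sub, ← smul_sub, norm_smul, Real.norm_of_nonneg hpos.le]
  have htri : dist (y j + nearestDist y j • A v) (y j + nearestDist y j • A w) ≤
      dist (f v) (y j + nearestDist y j • A v) + dist (f v) (y j + nearestDist y j • A w) := dist_triangle_left _ _ _
  rw [hvw] at htri
  have hfv := hf v hv'
  have hfw := hf w hw'
  rw [hvw] at hfv
  have hkey : nearestDist y j * (1 - 2 / 1000) ≤ nearestDist y j * ‖A v - A w‖ :=
    mul_le_mul_of_nonneg_left (by linarith) hpos.le
  nlinarith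

end Summit.AtomisticToContinuum.Crystallization.Theorems.OverbindingBudgetAffineCompressedCutStackTwo
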